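import Mathlib
import Literature.MathematicalPhysics.QuantumFieldTheory.Balaban1983to89.B5
import Literature.MathematicalPhysics.QuantumFieldTheory.Balaban1983to89.B5Prop11Plancherel

/-!
# B5 p. 28 «0 < γ₀ ≤ Δ₀(p′)φ_μ(p′) ≤ γ₁» and p. 29 (1.66) ⇒ (1.67) «γ₀⟨∂₁B,∂₁B⟩ ≤ ⟨B,Δ_kB⟩ ≤ γ₁⟨∂₁B,∂₁B⟩»
# — KERNEL, with explicit constants depending on `d` only, and the `B5.FormData` family of the
# unit torus discharging `B5.Bounds167` BY NAME

Source: T. Bałaban, *Propagators and renormalization transformations for lattice gauge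
theories. I*, Commun. Math. Phys. 95 (1984) 17–40 (`Balaban1984PropagatorsI`, "B5"), renders
`b2b-balaban-ref1/pages/1984-cmp95-propagators-rt-I/…-p012-x2.png` (journal p. 28) and
`…-p013-x2.png` (p. 29), read as images this session (SHARPEN T02.1 pass 29 of the cell).

## What the paper prints (verbatim)

p. 28 [PDF 12]: «Let us write this operator in momentum representation.
  (Q_kA)~_μ(p′) = Σ_l u(p′+l) v_μ(p′+l) Ã_μ(p′+l),  v_μ(p) = ∂¹_μ(p′)/∂_μ(p),   (1.61)
and operator φ as
  (φω)~_μ(p′) = φ_μ(p′) ω̃_μ(p′),  φ_μ(p′) = Σ_l |u(p′+l)|² |v_μ(p′+l)|² / Δ(p′+l),   (1.62)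
where we have omitted the subscript k. Multiplying φ_μ(p′) by Δ₀(p′), we get a well-defined
positive function for all p′ ∈ T̃₁^{(k)}, 0 < γ₀ ≤ Δ₀(p′)φ_μ(p′) ≤ γ₁.»

p. 29 [PDF 13]: «The action Δ_k is thus defined by  ⟨B, Δ_kB⟩ = ⟨∂H_kB, ∂H_kB⟩.   (1.65)
Using formulas (1.60) or (1.63) we obtain the following expression
  ⟨B, Δ_kB⟩ = ½ Σ_{μ,ν} ⟨(∂¹_μB_ν − ∂¹_νB_μ), φ_μ⁻¹φ_ν⁻¹(∂₁*φ⁻¹∂₁)⁻¹(∂¹_μB_ν − ∂¹_νB_μ)⟩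
           = ⟨∂₁B, σ_k∂₁B⟩
           = ½ Σ_{μ,ν} (2π)^{−d} ∫dp′ [ (Σ_{λ=1}^{d} |∂¹_λ(p′)|²/(Δ₀²(p′)φ_λ(p′))) Δ₀(p′)φ_μ(p′)Δ₀(p′)φ_ν(p′) ]⁻¹
                                    |(∂₁B)~_{μν}(p′)|².   (1.66)
The function under the integral is bounded from below and above by positive constants γ₀, γ₁
dependent on d only, so we have
  γ₀⟨∂₁B, ∂₁B⟩ ≤ ⟨B, Δ_kB⟩ ≤ γ₁⟨∂₁B, ∂₁B⟩.   (1.67)»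

## What this module types, and certifies in the kernel

All symbols are the ones already typed in the tree for Prop. 1.1 (passes 2–3 of the cell's
T02.1 chain): at reduced momentum `p′ = s` (`|s_μ| ≤ π`) and offset `l = 2πk`, `k : Fin d → Fin n`
(`n = η⁻¹ = L^k`), `u(p′+l) = B5Prop11Fiber.uSym n k s`, `v_μ(p′+l) = B5Prop11Fiber.vSym n k s μ`
((1.61), squared moduli `= B4Strip.Ur`, `B4Strip.uFactorr` by `norm_uSym_sq`, `norm_vSym_sq`),
`Δ(p′+l) = B4Strip.DeltaXir n 0 (shiftr n k s)` (`= Σ_μ|∂_μ(p′+l)|²`, `B5Prop11Fiber.Delta_eq`),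
`Δ₀(p′) = B4Strip.Delta1r 0 s` (`= Σ_μ|∂¹_μ(p′)|²`, `Delta0_eq`), `∂¹_μ(p′) = B5Prop11Fiber.d1Sym s μ`.

§1 `phi162 n μ s` := the right-hand side of (1.62), verbatim; `phi162_eq` (its real-leaf form),
`phiMu_eq_one_add` (the tree's typed (1.84) of Prop. 1.1 is `1 + a·`(1.62):
`B5Prop11Leaves.phiMu n a μ s = 1 + a·phi162 n μ s`).  `Delta0_phi162_lower` / `Delta0_phi162_le_one`: the printed
sentence «0 < γ₀ ≤ Δ₀(p′)φ_μ(p′) ≤ γ₁» PROVED on the punctured Brillouin zone (`s ≠ 0`) for every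
`n ≥ 1`, with OUR explicit constants `γ₀ = (4/π²)^{d+2}`, `γ₁ = 1` (d only; the paper prints none).
Proof = the one the cell's referees gave by hand (GAPS C-B5-9 numerically, C-adv4-31 analytically):
lower bound from the `l = 0` term and Jordan's inequality, upper bound from `|v_μ|² ≤ 1`,
`Δ₀(p′) ≤ Δ(p′+l)` and `Σ_l |u(p′+l)|² = 1` (`B5Prop11Leaves.sum_Ur_eq_one`).

§2 `w166 n μ ν s` := the function under the integral in (1.66) (third expression), verbatim;
`w166_bounds`: `(4/π²)^{d+2} ≤ w166 ≤ (π²/4)^{2d+4}` on the punctured zone — «bounded from below and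
above by positive constants γ₀, γ₁ dependent on d only» with OUR explicit constants (C-adv4-32's
`[γ₀/γ₁², γ₁/γ₀²]`): `Σ_λ |∂¹_λ|²/(Δ₀²φ_λ)` is a convex combination of the `(Δ₀φ_λ)⁻¹`.

§3 `sandwich_sum`: the bookkeeping «weight in [γ₀, γ₁] wherever the density is non-zero ⇒ (1.67)».

§4 THE UNIT TORUS.  Configurations are complex vector fields `B : Tor M × Fin d → ℂ` on the finite
torus `T₁ = Π_μ ℤ/M_μ` (`B5Prop11Plancherel.Tor M`, any `M_μ ≥ 1`); `∂¹_μ` is the unit forward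
difference `fdiff M 1 μ` of `B5Prop11Plancherel` §3 and `curl M B μ ν = ∂¹_μB_ν − ∂¹_νB_μ` the
printed `(∂₁B)_{μν}`; `d1Sq M B = ⟨∂₁B,∂₁B⟩ := ½ Σ_{μ,ν} Σ_x |(∂₁B)_{μν}(x)|²` (the `½Σ_{μ,ν}` over
ordered pairs of (1.66), = `Σ_{μ<ν}`); `hat M B ν = B̃_ν` := the unitary DFT `dft M` of the component
`B_ν`; `curlHat M B μ ν p = ∂¹_μ(p′)B̃_ν(p′) − ∂¹_ν(p′)B̃_μ(p′)` and `hat_curl`: it IS `(∂₁B)~_{μν}`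
(Fourier-multiplier identity `fsym_one`/`hat_fdiff`: the symbol of `fdiff M 1 μ` at the coarse class
`p` is `∂¹_μ(sOf M p)`); `sum_norm_sq_dft`: Plancherel for `dft M`; `formDk n M B` := ⟨B,Δ_kB⟩ AS
GIVEN BY THE THIRD EXPRESSION OF (1.66), `½ Σ_{μ,ν} Σ_{p′} w166(p′) |(∂₁B)~_{μν}(p′)|²` (the torus sum
`Σ_{p′∈T̃₁}` with the unitary normalisation replaces `(2π)^{−d}∫dp′`; (1.67) is insensitive to the
common normalisation of both sides, cf. `d1Sq_eq_sum_hat`).  `ineq167`: (1.67) with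
`γ₀ = (4/π²)^{d+2}`, `γ₁ = (π²/4)^{2d+4}` for every `n ≥ 1`, every `M`, every `B` (the `p′ = 0` term,
where the paper defines the integrand «as a limit», carries `(∂₁B)~(0) = 0` and drops out:
`curlHat_eq_zero_of`).  `formOfLattice n M : B5.FormData` packages `(Cfg, formΔk, d1Sq) :=
(Tor M × Fin d → ℂ, formDk n M, d1Sq M)` and `bounds167_formOfLattice` proves
`B5.Bounds167 (fun i => formOfLattice (n i) (M i))` for EVERY family of sizes `n i ≥ 1`, `M i`
— the abstract (1.67) of `B5.lean` (consumed by `B6.h2118_of_B5`) discharged by name for these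
carriers; `formOfLatticeR` / `bounds167_formOfLatticeR`: the same for real fields `B : T₁ → ℝ^d`.

## What is NOT claimed

(1) The identity (1.65) = (1.66) — that the third expression of (1.66) equals ⟨∂H_kB, ∂H_kB⟩ for
the minimiser `H_kB` of (1.59)/(1.60) — is NOT certified here: `formDk` is DEFINED by the printed
momentum representation (1.66) (the cell holds (1.66) by hand, GAPS C-adv4-32, and numerically,
C-B5-9 (E7)).  (2) No value of `γ₀`, `γ₁` is attributed to the paper; ours are far from optimal.
(3) At `p′ = 0` the typed `phi162`, `w166` carry junk values (division by `Δ₀(0) = 0`); the printed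
«well-defined positive function for all p′» (a limit at `p′ = 0`) is certified on `p′ ≠ 0` only,
which is all (1.67) uses.  (4) B5's sizes `n = L^k`, `M_μ = 2L′_μ` (unit lattice of (1.29)) are
instances of the arbitrary `n ≥ 1`, `M_μ ≥ 1`.  Nothing here is progress on a summit; value =
kernel certificate of two printed constant claims + a by-name instance of the cell's leaf `B5.Bounds167`.
-/

noncomputable section

namespace Literature.MathematicalPhysics.QuantumFieldTheory.Balaban1983to89.B5Bounds167Lattice

open scoped BigOperators Matrix ComplexConjugate
open Finset Complex
open Literature.MathematicalPhysics.QuantumFieldTheory.Balaban1983to89.B4Strip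
open Literature.MathematicalPhysics.QuantumFieldTheory.Balaban1983to89.B5Prop11Leaves
open Literature.MathematicalPhysics.QuantumFieldTheory.Balaban1983to89.B5Prop11Fiber
open Literature.MathematicalPhysics.QuantumFieldTheory.Balaban1983to89.B5Prop11Plancherel

variable {d : ℕ}

/-! ## §1. (1.62) and the sentence «0 < γ₀ ≤ Δ₀(p′)φ_μ(p′) ≤ γ₁» -/

section Phi

/-- (1.62) verbatim: «φ_μ(p′) = Σ_l |u(p′+l)|² |v_μ(p′+l)|² / Δ(p′+l)» at `p′ = s`, `l = 2πk`,
`k : Fin d → Fin n`, with the typed `u`, `v_μ` of (1.61) (`uSym`, `vSym`) and `Δ(p′+l) = DeltaXir n 0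
(shiftr n k s)`. [cite: Balaban1984PropagatorsI, (1.62) p.28] -/
def phi162 (n : ℕ) (μ : Fin d) (s : Fin d → ℝ) : ℝ :=
  ∑ k : Fin d → Fin n, ‖uSym n k s‖ ^ 2 * ‖vSym n k s μ‖ ^ 2 / DeltaXir n 0 (shiftr n k s)

/-- (1.62) over the real leaves: `φ_μ(s) = Σ_k Ur·uFactorr/Δ(shift)` on the Brillouin zone
(`|u|² = Ur`, `|v_μ|² = uFactorr`). [folklore] -/
theorem phi162_eq (n : ℕ) [NeZero n] (hn : 1 ≤ n) (μ : Fin d) (s : Fin d → ℝ)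
    (hs : ∀ ν, |s ν| ≤ Real.pi) :
    phi162 n μ s
      = ∑ k : Fin d → Fin n, Ur n k s * uFactorr n (k μ : ℕ) (s μ) / DeltaXir n 0 (shiftr n k s) := by
  unfold phi162
  refine Finset.sum_congr rfl fun k _ => ?_
  rw [norm_uSym_sq n hn k s hs, norm_vSym_sq n hn k s μ (hs μ)]

/-- the typed (1.84) of Prop. 1.1 («φ_μ(p′) = 1 + a Σ_{l″} |u(p′+l″)|² |v_μ(p′+l″)|² / Δ(p′+l″)»,
`B5Prop11Leaves.phiMu`) is `1 + a·`(1.62): `phiMu n a μ s = 1 + a·phi162 n μ s` on the Brillouin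
zone. [cite: Balaban1984PropagatorsI, (1.62) p.28, (1.84) p.31] -/
theorem phiMu_eq_one_add (n : ℕ) [NeZero n] (hn : 1 ≤ n) (a : ℝ) (μ : Fin d) (s : Fin d → ℝ)
    (hs : ∀ ν, |s ν| ≤ Real.pi) : phiMu n a μ s = 1 + a * phi162 n μ s := by
  rw [phi162_eq n hn μ s hs]
  rfl

/-- `φ_μ(s) ≥ 0`. [folklore] -/
theorem phi162_nonneg (n : ℕ) (μ : Fin d) (s : Fin d → ℝ) : 0 ≤ phi162 n μ s :=
  Finset.sum_nonneg fun _ _ =>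
    div_nonneg (mul_nonneg (sq_nonneg _) (sq_nonneg _)) (DeltaXir_nonneg n 0 le_rfl _)

/-- «0 < γ₀ ≤ Δ₀(p′)φ_μ(p′)», LOWER BOUND with OUR constant `γ₀ = (4/π²)^{d+2}` (d only): on the
punctured Brillouin zone, for every `n = L^k ≥ 1`, `(4/π²)^{d+2} ≤ Δ₀(p′)φ_μ(p′)` — keep the `l = 0`
term, `|u(p′)|² ≥ (4/π²)^d`, `|v_μ(p′)|² ≥ 4/π²`, `Δ₀(p′)/Δ(p′) ≥ 4/π²` (Jordan).
[cite: Balaban1984PropagatorsI, p.28 after (1.62)] -/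
theorem Delta0_phi162_lower (n : ℕ) [NeZero n] (hn : 1 ≤ n) (μ : Fin d) (s : Fin d → ℝ)
    (hs : ∀ ν, |s ν| ≤ Real.pi) (ν₀ : Fin d) (hν₀ : s ν₀ ≠ 0) :
    (4 / Real.pi ^ 2) ^ (d + 2) ≤ Delta1r 0 s * phi162 n μ s := by
  have hD : 0 < DeltaXir n 0 s := DeltaXir_pos n hn s hs ν₀ hν₀
  have hΔ0 : 0 ≤ Delta1r 0 s := Delta1r_nonneg 0 le_rfl s
  have hpi := Real.pi_pos
  have h1 : (4 / Real.pi ^ 2) ^ d ≤ Ur n (fun _ => (0 : Fin n)) s := Ur_zero_ge n hn s hs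
  have h2 : 4 / Real.pi ^ 2 ≤ uFactorr n ((fun _ => (0 : Fin n)) μ : ℕ) (s μ) := by
    simpa using uFactorr_zero_ge n hn (s μ) (hs μ)
  have h3 : 4 / Real.pi ^ 2 ≤ Delta1r 0 s / DeltaXir n 0 s := by
    rw [le_div_iff₀ hD]
    have h4 := DeltaXir_le_Delta1r n s hs
    calc 4 / Real.pi ^ 2 * DeltaXir n 0 s ≤ 4 / Real.pi ^ 2 * (Real.pi ^ 2 / 4 * Delta1r 0 s) :=
          mul_le_mul_of_nonneg_left h4 (by positivity)
      _ = Delta1r 0 s := by field_simp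
  have h123 : (4 / Real.pi ^ 2) ^ d * (4 / Real.pi ^ 2) * (4 / Real.pi ^ 2)
      ≤ Ur n (fun _ => (0 : Fin n)) s * uFactorr n ((fun _ => (0 : Fin n)) μ : ℕ) (s μ)
          * (Delta1r 0 s / DeltaXir n 0 s) :=
    mul_le_mul (mul_le_mul h1 h2 (by positivity) (Ur_nonneg _ _ _)) h3 (by positivity)
      (mul_nonneg (Ur_nonneg _ _ _) (uFactorr_nonneg _ _ _))
  set f : (Fin d → Fin n) → ℝ :=
    fun k => Ur n k s * uFactorr n (k μ : ℕ) (s μ) / DeltaXir n 0 (shiftr n k s) with hf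
  have hsum : f (fun _ => 0) ≤ ∑ k, f k :=
    Finset.single_le_sum (fun k _ => phiMu_term_nonneg n μ s k) (Finset.mem_univ _)
  have hf0 : f (fun _ => 0) * Delta1r 0 s
      = Ur n (fun _ => (0 : Fin n)) s * uFactorr n ((fun _ => (0 : Fin n)) μ : ℕ) (s μ)
          * (Delta1r 0 s / DeltaXir n 0 s) := by
    rw [hf]; simp only [shiftr_zero]; ring
  have hmain : Delta1r 0 s * phi162 n μ s = (∑ k, f k) * Delta1r 0 s := by
    rw [phi162_eq n hn μ s hs, hf]; ring
  rw [hmain]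
  calc (4 / Real.pi ^ 2) ^ (d + 2)
      = (4 / Real.pi ^ 2) ^ d * (4 / Real.pi ^ 2) * (4 / Real.pi ^ 2) := by ring
    _ ≤ f (fun _ => 0) * Delta1r 0 s := by rw [hf0]; exact h123
    _ ≤ (∑ k, f k) * Delta1r 0 s := mul_le_mul_of_nonneg_right hsum hΔ0

/-- «Δ₀(p′)φ_μ(p′) ≤ γ₁», UPPER BOUND with OUR constant `γ₁ = 1`: on the Brillouin zone, for every
`n = L^k ≥ 1`, `Δ₀(p′)φ_μ(p′) ≤ Σ_l |u(p′+l)|² = 1` — by `|v_μ(p′+l)|² ≤ 1`, `Δ₀(p′) ≤ Δ(p′+l)`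
and E4 `Σ_l |u(p′+l)|² = 1` (`sum_Ur_eq_one`). [cite: Balaban1984PropagatorsI, p.28 after (1.62)] -/
theorem Delta0_phi162_le_one (n : ℕ) [NeZero n] (hn : 1 ≤ n) (μ : Fin d) (s : Fin d → ℝ)
    (hs : ∀ ν, |s ν| ≤ Real.pi) : Delta1r 0 s * phi162 n μ s ≤ 1 := by
  rw [phi162_eq n hn μ s hs, Finset.mul_sum, ← sum_Ur_eq_one n hn s hs]
  refine Finset.sum_le_sum fun k _ => ?_
  have hU0 := Ur_nonneg n k s
  have hv := uFactorr_le_one n hn (k μ : ℕ) (s μ)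
  have hv0 := uFactorr_nonneg n (k μ : ℕ) (s μ)
  have hΔ0 : 0 ≤ Delta1r 0 s := Delta1r_nonneg 0 le_rfl s
  rcases (DeltaXir_nonneg n 0 le_rfl (shiftr n k s)).eq_or_lt with h0 | hpos
  · rw [← h0, div_zero, mul_zero]; exact hU0
  · have hle := Delta1r_le_DeltaXir_shift n hn k s
    rw [mul_div_assoc', div_le_iff₀ hpos]
    calc Delta1r 0 s * (Ur n k s * uFactorr n (k μ : ℕ) (s μ))
        ≤ DeltaXir n 0 (shiftr n k s) * (Ur n k s * 1) :=
          mul_le_mul hle (mul_le_mul_of_nonneg_left hv hU0) (mul_nonneg hU0 hv0) (le_trans hΔ0 hle)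
      _ = Ur n k s * DeltaXir n 0 (shiftr n k s) := by ring

/-- the printed sentence in one line, with OUR constants: on the punctured Brillouin zone, for every
`n = L^k ≥ 1` and every direction `μ`, `0 < (4/π²)^{d+2} ≤ Δ₀(p′)φ_μ(p′) ≤ 1`.
[cite: Balaban1984PropagatorsI, p.28 after (1.62)] -/
theorem Delta0_phi162_bounds (n : ℕ) [NeZero n] (hn : 1 ≤ n) (μ : Fin d) (s : Fin d → ℝ)
    (hs : ∀ ν, |s ν| ≤ Real.pi) (ν₀ : Fin d) (hν₀ : s ν₀ ≠ 0) :
    0 < (4 / Real.pi ^ 2 : ℝ) ^ (d + 2) ∧ (4 / Real.pi ^ 2) ^ (d + 2) ≤ Delta1r 0 s * phi162 n μ s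
      ∧ Delta1r 0 s * phi162 n μ s ≤ 1 :=
  ⟨by positivity, Delta0_phi162_lower n hn μ s hs ν₀ hν₀, Delta0_phi162_le_one n hn μ s hs⟩

end Phi

/-! ## §2. The function under the integral in (1.66) and its two-sided bound -/

section Weight

/-- the function under the integral in (1.66) (third expression), verbatim:
`[ (Σ_{λ=1}^{d} |∂¹_λ(p′)|²/(Δ₀²(p′)φ_λ(p′))) · Δ₀(p′)φ_μ(p′) · Δ₀(p′)φ_ν(p′) ]⁻¹` at `p′ = s`
(`∂¹_λ = d1Sym`, `Δ₀ = Delta1r 0`, `φ_λ = phi162`). [cite: Balaban1984PropagatorsI, (1.66) p.29] -/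
def w166 (n : ℕ) (μ ν : Fin d) (s : Fin d → ℝ) : ℝ :=
  1 / ((∑ κ : Fin d, ‖d1Sym s κ‖ ^ 2 / (Delta1r 0 s ^ 2 * phi162 n κ s))
        * (Delta1r 0 s * phi162 n μ s) * (Delta1r 0 s * phi162 n ν s))

/-- «The function under the integral is bounded from below and above by positive constants γ₀, γ₁
dependent on d only» — with OUR constants: on the punctured Brillouin zone, for every `n = L^k ≥ 1`,
`(4/π²)^{d+2} ≤ w166 ≤ (π²/4)^{2d+4}`.  (With `γ := (4/π²)^{d+2}`: `Δ₀φ_λ ∈ [γ, 1]` (§1), hence the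
convex combination `Σ_λ (|∂¹_λ|²/Δ₀)·(Δ₀φ_λ)⁻¹ ∈ [1, γ⁻¹]`, the bracket `∈ [γ², γ⁻¹]`, its inverse
`∈ [γ, γ⁻²]`.) [cite: Balaban1984PropagatorsI, p.29 after (1.66)] -/
theorem w166_bounds (n : ℕ) [NeZero n] (hn : 1 ≤ n) (μ ν : Fin d) (s : Fin d → ℝ)
    (hs : ∀ κ, |s κ| ≤ Real.pi) (ν₀ : Fin d) (hν₀ : s ν₀ ≠ 0) :
    (4 / Real.pi ^ 2) ^ (d + 2) ≤ w166 n μ ν s ∧ w166 n μ ν s ≤ (Real.pi ^ 2 / 4) ^ (2 * d + 4) := by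
  have hpi := Real.pi_pos
  have hγpos : 0 < (4 / Real.pi ^ 2 : ℝ) ^ (d + 2) := by positivity
  have hγinv : (Real.pi ^ 2 / 4 : ℝ) ^ (2 * d + 4) = 1 / ((4 / Real.pi ^ 2) ^ (d + 2)) ^ 2 := by
    rw [← pow_mul, show (d + 2) * 2 = 2 * d + 4 by ring, one_div, ← inv_pow, inv_div]
  have hx : ∀ κ, (4 / Real.pi ^ 2) ^ (d + 2) ≤ Delta1r 0 s * phi162 n κ s
      ∧ Delta1r 0 s * phi162 n κ s ≤ 1 :=
    fun κ => ⟨Delta0_phi162_lower n hn κ s hs ν₀ hν₀, Delta0_phi162_le_one n hn κ s hs⟩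
  have hΔpos : 0 < Delta1r 0 s := Delta1r_pos s hs ν₀ hν₀
  have hsumS : ∑ κ : Fin d, S1r (s κ) = Delta1r 0 s := by unfold Delta1r; simp
  have hterm : ∀ κ, ‖d1Sym s κ‖ ^ 2 / (Delta1r 0 s ^ 2 * phi162 n κ s)
      = (S1r (s κ) / Delta1r 0 s) * (1 / (Delta1r 0 s * phi162 n κ s)) := by
    intro κ
    rw [norm_d1Sym_sq, div_mul_div_comm, mul_one, sq, mul_assoc]
  have hw : ∀ κ, 0 ≤ S1r (s κ) / Delta1r 0 s := fun κ => div_nonneg (S1r_nonneg _) hΔpos.le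
  have hwsum : ∑ κ : Fin d, S1r (s κ) / Delta1r 0 s = 1 := by
    rw [← Finset.sum_div, hsumS, div_self hΔpos.ne']
  -- the convex combination `c := Σ_κ (S1r/Δ₀)·(Δ₀φ_κ)⁻¹ ∈ [1, γ⁻¹]`
  have hc_lo : 1 ≤ ∑ κ : Fin d, ‖d1Sym s κ‖ ^ 2 / (Delta1r 0 s ^ 2 * phi162 n κ s) := by
    calc (1 : ℝ) = ∑ κ : Fin d, (S1r (s κ) / Delta1r 0 s) * 1 := by
          rw [← Finset.sum_mul, hwsum, one_mul]
      _ ≤ ∑ κ : Fin d, (S1r (s κ) / Delta1r 0 s) * (1 / (Delta1r 0 s * phi162 n κ s)) := by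
          refine Finset.sum_le_sum fun κ _ => mul_le_mul_of_nonneg_left ?_ (hw κ)
          rw [le_div_iff₀ (lt_of_lt_of_le hγpos (hx κ).1), one_mul]
          exact (hx κ).2
      _ = ∑ κ : Fin d, ‖d1Sym s κ‖ ^ 2 / (Delta1r 0 s ^ 2 * phi162 n κ s) :=
          Finset.sum_congr rfl fun κ _ => (hterm κ).symm
  have hc_hi : ∑ κ : Fin d, ‖d1Sym s κ‖ ^ 2 / (Delta1r 0 s ^ 2 * phi162 n κ s)
      ≤ 1 / (4 / Real.pi ^ 2) ^ (d + 2) := by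
    calc ∑ κ : Fin d, ‖d1Sym s κ‖ ^ 2 / (Delta1r 0 s ^ 2 * phi162 n κ s)
        = ∑ κ : Fin d, (S1r (s κ) / Delta1r 0 s) * (1 / (Delta1r 0 s * phi162 n κ s)) :=
          Finset.sum_congr rfl fun κ _ => hterm κ
      _ ≤ ∑ κ : Fin d, (S1r (s κ) / Delta1r 0 s) * (1 / (4 / Real.pi ^ 2) ^ (d + 2)) := by
          refine Finset.sum_le_sum fun κ _ => mul_le_mul_of_nonneg_left ?_ (hw κ)
          exact one_div_le_one_div_of_le hγpos (hx κ).1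
      _ = 1 / (4 / Real.pi ^ 2) ^ (d + 2) := by rw [← Finset.sum_mul, hwsum, one_mul]
  set c : ℝ := ∑ κ : Fin d, ‖d1Sym s κ‖ ^ 2 / (Delta1r 0 s ^ 2 * phi162 n κ s) with hc
  set X : ℝ := Delta1r 0 s * phi162 n μ s with hX
  set Y : ℝ := Delta1r 0 s * phi162 n ν s with hY
  have hXb := hx μ
  have hYb := hx ν
  rw [← hX] at hXb
  rw [← hY] at hYb
  have hXpos : 0 < X := lt_of_lt_of_le hγpos hXb.1
  have hYpos : 0 < Y := lt_of_lt_of_le hγpos hYb.1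
  have hDlo : ((4 / Real.pi ^ 2) ^ (d + 2)) ^ 2 ≤ c * X * Y := by
    rw [sq, mul_assoc]
    calc (4 / Real.pi ^ 2) ^ (d + 2) * (4 / Real.pi ^ 2) ^ (d + 2) ≤ X * Y :=
          mul_le_mul hXb.1 hYb.1 hγpos.le hXpos.le
      _ = 1 * (X * Y) := (one_mul _).symm
      _ ≤ c * (X * Y) := mul_le_mul_of_nonneg_right hc_lo (mul_nonneg hXpos.le hYpos.le)
  have hDhi : c * X * Y ≤ 1 / (4 / Real.pi ^ 2) ^ (d + 2) := by
    rw [mul_assoc]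
    calc c * (X * Y) ≤ (1 / (4 / Real.pi ^ 2) ^ (d + 2)) * 1 := by
          refine mul_le_mul hc_hi ?_ (mul_nonneg hXpos.le hYpos.le) (by positivity)
          calc X * Y ≤ 1 * 1 := mul_le_mul hXb.2 hYb.2 hYpos.le zero_le_one
            _ = 1 := one_mul 1
      _ = 1 / (4 / Real.pi ^ 2) ^ (d + 2) := mul_one _
  have hDpos : 0 < c * X * Y := lt_of_lt_of_le (by positivity) hDlo
  unfold w166
  rw [← hc, ← hX, ← hY]
  constructor
  · calc (4 / Real.pi ^ 2) ^ (d + 2) = 1 / (1 / (4 / Real.pi ^ 2) ^ (d + 2)) := by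
          rw [one_div_one_div]
      _ ≤ 1 / (c * X * Y) := one_div_le_one_div_of_le hDpos hDhi
  · rw [hγinv]
    exact one_div_le_one_div_of_le (by positivity) hDlo

end Weight

/-! ## §3. The bookkeeping «weight ∈ [γ₀, γ₁] ⇒ (1.67)» -/

section Sandwich

/-- if `ρ ≥ 0` and the weight lies in `[γ₀, γ₁]` wherever `ρ ≠ 0`, then
`γ₀ Σ ρ ≤ Σ w·ρ ≤ γ₁ Σ ρ`. [folklore] -/
theorem sandwich_sum {P : Type*} [Fintype P] (ρ w : P → ℝ) (γ₀ γ₁ : ℝ)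
    (hρ : ∀ p, 0 ≤ ρ p) (hw : ∀ p, ρ p ≠ 0 → γ₀ ≤ w p ∧ w p ≤ γ₁) :
    γ₀ * ∑ p, ρ p ≤ ∑ p, w p * ρ p ∧ ∑ p, w p * ρ p ≤ γ₁ * ∑ p, ρ p := by
  constructor
  · rw [Finset.mul_sum]
    refine Finset.sum_le_sum fun p _ => ?_
    by_cases h : ρ p = 0
    · rw [h, mul_zero, mul_zero]
    · exact mul_le_mul_of_nonneg_right (hw p h).1 (hρ p)
  · rw [Finset.mul_sum]
    refine Finset.sum_le_sum fun p _ => ?_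
    by_cases h : ρ p = 0
    · rw [h, mul_zero, mul_zero]
    · exact mul_le_mul_of_nonneg_right (hw p h).2 (hρ p)

end Sandwich

/-! ## §4. The unit torus: `⟨∂₁B,∂₁B⟩`, `⟨B,Δ_kB⟩` by (1.66), (1.67), and `B5.Bounds167` by name -/

section Lattice

variable (n : ℕ) (M : Fin d → ℕ) [hM : ∀ μ, NeZero (M μ)]

/-- the component `B_ν` of a vector field `B : T₁ → ℂ^d` as a scalar field. [folklore] -/
def comp (B : Tor M × Fin d → ℂ) (ν : Fin d) : Tor M → ℂ := fun x => B (x, ν)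

/-- `B̃_ν(p′)`: the (unitary) discrete Fourier transform of the component `B_ν`
((1.29) up to the constant normalisation). [cite: Balaban1984PropagatorsI, (1.29) p.23] -/
def hat (B : Tor M × Fin d → ℂ) (ν : Fin d) : Tor M → ℂ := dft M *ᵥ comp M B ν

/-- `(∂₁B)_{μν}(x) = (∂¹_μB_ν)(x) − (∂¹_νB_μ)(x)` with the unit forward difference
`(∂¹_μf)(x) = f(x + e_μ) − f(x)` (`fdiff M 1 μ`). [cite: Balaban1984PropagatorsI, (1.66) p.29] -/
def curl (B : Tor M × Fin d → ℂ) (μ ν : Fin d) : Tor M → ℂ :=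
  fun x => (fdiff M (1 : ℂ) μ *ᵥ B) (x, ν) - (fdiff M (1 : ℂ) ν *ᵥ B) (x, μ)

/-- `∂¹_μ(p′)B̃_ν(p′) − ∂¹_ν(p′)B̃_μ(p′)` at the coarse class `p` (`p′ = sOf M p`); by `hat_curl` this
IS `(∂₁B)~_{μν}(p′)`. [cite: Balaban1984PropagatorsI, (1.66) p.29] -/
def curlHat (B : Tor M × Fin d → ℂ) (μ ν : Fin d) : Tor M → ℂ :=
  fun p => d1Sym (sOf M p) μ * hat M B ν p - d1Sym (sOf M p) ν * hat M B μ p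

/-- `⟨∂₁B, ∂₁B⟩ := ½ Σ_{μ,ν} Σ_x |(∂₁B)_{μν}(x)|²` (ordered pairs, the `½Σ_{μ,ν}` of (1.66); the
unweighted `ℓ²` sum over the torus — a common positive normalisation of both sides of (1.67) is
immaterial). [cite: Balaban1984PropagatorsI, (1.66)–(1.67) p.29] -/
def d1Sq (B : Tor M × Fin d → ℂ) : ℝ := 1 / 2 * ∑ μ, ∑ ν, ∑ x, ‖curl M B μ ν x‖ ^ 2

/-- `⟨B, Δ_kB⟩` AS GIVEN BY THE THIRD EXPRESSION OF (1.66):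
`½ Σ_{μ,ν} Σ_{p′} w166(p′) |(∂₁B)~_{μν}(p′)|²` (torus sum with the unitary DFT in place of
`(2π)^{−d}∫dp′`; the identity with (1.65) is NOT certified, see the module header).
[cite: Balaban1984PropagatorsI, (1.66) p.29] -/
def formDk (B : Tor M × Fin d → ℂ) : ℝ :=
  1 / 2 * ∑ μ, ∑ ν, ∑ p, w166 n μ ν (sOf M p) * ‖curlHat M B μ ν p‖ ^ 2

/-- the Fourier symbol of the unit forward difference `fdiff M 1 μ` at the coarse class `p` is
`∂¹_μ(p′) = e^{ip′_μ} − 1`, `p′ = sOf M p`. [cite: Balaban1984PropagatorsI, (1.31) p.23] -/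
theorem fsym_one (p : Tor M) (μ ν : Fin d) : fsym M (1 : ℂ) μ (p, ν) = d1Sym (sOf M p) μ := by
  have h1 : (ZMod.stdAddChar (N := M μ)) (p μ)
      = Complex.exp (2 * Real.pi * I * (((p μ).valMinAbs : ℤ) : ℂ) / ((M μ : ℕ) : ℂ)) := by
    conv_lhs => rw [← ZMod.coe_valMinAbs (p μ)]
    exact ZMod.stdAddChar_coe _
  have h2 : (2 * Real.pi * I * (((p μ).valMinAbs : ℤ) : ℂ) / ((M μ : ℕ) : ℂ))
      = (((2 * Real.pi * ((p μ).valMinAbs : ℝ) / (M μ : ℝ) : ℝ) : ℂ) * I) := by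
    push_cast
    ring
  show (1 : ℂ) * ((ZMod.stdAddChar (N := M μ)) (p μ) - 1)
    = Complex.exp ((((2 * Real.pi * ((p μ).valMinAbs : ℝ) / (M μ : ℝ) : ℝ) : ℂ)) * I) - 1
  rw [one_mul, h1, h2]

/-- componentwise DFT = DFT of the component: `(U F)(p, ν) = (dft M F_ν)(p)`. [folklore] -/
theorem dftV_mulVec_apply (F : Tor M × Fin d → ℂ) (p : Tor M) (ν : Fin d) :
    (dftV M *ᵥ F) (p, ν) = (dft M *ᵥ fun x => F (x, ν)) p := by
  simp only [Matrix.mulVec, dotProduct]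
  rw [Fintype.sum_prod_type]
  refine Finset.sum_congr rfl fun x _ => ?_
  simp_rw [dftV_apply]
  rw [Finset.sum_eq_single ν]
  · rw [if_pos rfl]
  · intro κ _ hκ
    rw [if_neg (Ne.symm hκ), zero_mul]
  · intro h
    exact absurd (Finset.mem_univ ν) h

/-- `(∂¹_μB_ν)~(p′) = ∂¹_μ(p′)B̃_ν(p′)`: the unit forward difference is the Fourier multiplier with
symbol `∂¹_μ` (from `dftV_mul_fdiff`). [cite: Balaban1984PropagatorsI, (1.31) p.23] -/
theorem hat_fdiff (B : Tor M × Fin d → ℂ) (μ ν : Fin d) (p : Tor M) :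
    (dft M *ᵥ fun x => (fdiff M (1 : ℂ) μ *ᵥ B) (x, ν)) p = d1Sym (sOf M p) μ * hat M B ν p := by
  calc (dft M *ᵥ fun x => (fdiff M (1 : ℂ) μ *ᵥ B) (x, ν)) p
      = (dftV M *ᵥ (fdiff M (1 : ℂ) μ *ᵥ B)) (p, ν) := (dftV_mulVec_apply M _ p ν).symm
    _ = ((dftV M * fdiff M (1 : ℂ) μ) *ᵥ B) (p, ν) := by rw [Matrix.mulVec_mulVec]
    _ = ((Matrix.diagonal (fsym M (1 : ℂ) μ) * dftV M) *ᵥ B) (p, ν) := by rw [dftV_mul_fdiff]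
    _ = fsym M (1 : ℂ) μ (p, ν) * (dftV M *ᵥ B) (p, ν) := by
        rw [← Matrix.mulVec_mulVec, Matrix.mulVec_diagonal]
    _ = d1Sym (sOf M p) μ * hat M B ν p := by
        rw [fsym_one, dftV_mulVec_apply]
        rfl

/-- `(∂₁B)~_{μν} = ∂¹_μB̃_ν − ∂¹_νB̃_μ`: the DFT of `curl` is `curlHat`. [cite: Balaban1984PropagatorsI, (1.66) p.29] -/
theorem hat_curl (B : Tor M × Fin d → ℂ) (μ ν : Fin d) (p : Tor M) :
    (dft M *ᵥ curl M B μ ν) p = curlHat M B μ ν p := by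
  have hlin : curl M B μ ν
      = (fun x => (fdiff M (1 : ℂ) μ *ᵥ B) (x, ν)) - (fun x => (fdiff M (1 : ℂ) ν *ᵥ B) (x, μ)) := rfl
  rw [hlin, Matrix.mulVec_sub, Pi.sub_apply, hat_fdiff, hat_fdiff]
  rfl

/-- Plancherel for the unitary DFT of the torus: `Σ_p |(dft M f)(p)|² = Σ_x |f(x)|²`. [folklore] -/
theorem sum_norm_sq_dft (f : Tor M → ℂ) : ∑ p, ‖(dft M *ᵥ f) p‖ ^ 2 = ∑ x, ‖f x‖ ^ 2 := by
  have hU : star (dft M) * dft M = 1 := Matrix.mem_unitaryGroup_iff'.mp (dft_mem_unitaryGroup M)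
  have key : star (dft M *ᵥ f) ⬝ᵥ (dft M *ᵥ f) = star f ⬝ᵥ f := by
    rw [Matrix.star_mulVec, ← Matrix.dotProduct_mulVec, Matrix.mulVec_mulVec,
      ← Matrix.star_eq_conjTranspose, hU, Matrix.one_mulVec]
  have h2 : ∀ g : Tor M → ℂ, star g ⬝ᵥ g = ((∑ x, ‖g x‖ ^ 2 : ℝ) : ℂ) := by
    intro g
    simp only [dotProduct, Pi.star_apply, Complex.star_def, Complex.ofReal_sum, Complex.ofReal_pow]
    exact Finset.sum_congr rfl fun i _ => Complex.conj_mul' (g i)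
  rw [h2, h2] at key
  exact_mod_cast key

/-- at `p′ = 0` the momentum density vanishes: `(∂₁B)~(0) = 0` (`∂¹_μ(0) = 0`), so the junk value of
`w166` at `p′ = 0` is never weighted. [folklore] -/
theorem curlHat_eq_zero_of (B : Tor M × Fin d → ℂ) (μ ν : Fin d) (p : Tor M) (hp : sOf M p = 0) :
    curlHat M B μ ν p = 0 := by
  unfold curlHat d1Sym
  rw [hp]
  simp

/-- `⟨∂₁B, ∂₁B⟩` in momentum space (Plancherel): `= ½ Σ_{μ,ν} Σ_{p′} |(∂₁B)~_{μν}(p′)|²`.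
[cite: Balaban1984PropagatorsI, (1.66) p.29] -/
theorem d1Sq_eq_sum_hat (B : Tor M × Fin d → ℂ) :
    d1Sq M B = 1 / 2 * ∑ μ, ∑ ν, ∑ p, ‖curlHat M B μ ν p‖ ^ 2 := by
  unfold d1Sq
  congr 1
  refine Finset.sum_congr rfl fun μ _ => Finset.sum_congr rfl fun ν _ => ?_
  rw [← sum_norm_sq_dft M (curl M B μ ν)]
  exact Finset.sum_congr rfl fun p _ => by rw [hat_curl]

/-- the weight of (1.66) at a coarse class `p ≠ 0` lies in `[(4/π²)^{d+2}, (π²/4)^{2d+4}]`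
(`|p′_κ| ≤ π` by `abs_sOf_le`, `p′ ≠ 0`). [cite: Balaban1984PropagatorsI, p.29 after (1.66)] -/
theorem w166_sOf_bounds [NeZero n] (hn : 1 ≤ n) (μ ν : Fin d) (p : Tor M) (hp : sOf M p ≠ 0) :
    (4 / Real.pi ^ 2) ^ (d + 2) ≤ w166 n μ ν (sOf M p)
      ∧ w166 n μ ν (sOf M p) ≤ (Real.pi ^ 2 / 4) ^ (2 * d + 4) := by
  obtain ⟨ν₀, hν₀⟩ := Function.ne_iff.mp hp
  exact w166_bounds n hn μ ν (sOf M p) (abs_sOf_le M p) ν₀ hν₀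

/-- **(1.67)** for the unit torus, with OUR constants: for every `n = L^k ≥ 1`, every torus `T₁`
(sizes `M`), every vector field `B`,
`(4/π²)^{d+2} ⟨∂₁B,∂₁B⟩ ≤ ⟨B,Δ_kB⟩ ≤ (π²/4)^{2d+4} ⟨∂₁B,∂₁B⟩` (`⟨B,Δ_kB⟩` as given by (1.66)).
[cite: Balaban1984PropagatorsI, (1.67) p.29] -/
theorem ineq167 [NeZero n] (hn : 1 ≤ n) (B : Tor M × Fin d → ℂ) :
    (4 / Real.pi ^ 2) ^ (d + 2) * d1Sq M B ≤ formDk n M B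
      ∧ formDk n M B ≤ (Real.pi ^ 2 / 4) ^ (2 * d + 4) * d1Sq M B := by
  rw [d1Sq_eq_sum_hat]
  unfold formDk
  have key : ∀ μ ν, (4 / Real.pi ^ 2) ^ (d + 2) * ∑ p, ‖curlHat M B μ ν p‖ ^ 2
      ≤ ∑ p, w166 n μ ν (sOf M p) * ‖curlHat M B μ ν p‖ ^ 2
      ∧ ∑ p, w166 n μ ν (sOf M p) * ‖curlHat M B μ ν p‖ ^ 2
      ≤ (Real.pi ^ 2 / 4) ^ (2 * d + 4) * ∑ p, ‖curlHat M B μ ν p‖ ^ 2 := by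
    intro μ ν
    refine sandwich_sum (fun p => ‖curlHat M B μ ν p‖ ^ 2) (fun p => w166 n μ ν (sOf M p)) _ _
      (fun p => by positivity) ?_
    intro p hp
    have hs : sOf M p ≠ 0 := by
      intro h0
      apply hp
      simp only [curlHat_eq_zero_of M B μ ν p h0, norm_zero]
      norm_num
    exact w166_sOf_bounds n M hn μ ν p hs
  have hdist : ∀ c : ℝ, c * ∑ μ, ∑ ν, ∑ p, ‖curlHat M B μ ν p‖ ^ 2
      = ∑ μ, ∑ ν, c * ∑ p, ‖curlHat M B μ ν p‖ ^ 2 := by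
    intro c
    rw [Finset.mul_sum]
    exact Finset.sum_congr rfl fun μ _ => Finset.mul_sum _ _ _
  constructor
  · rw [← mul_assoc, mul_comm ((4 / Real.pi ^ 2) ^ (d + 2)) (1 / 2), mul_assoc, hdist]
    refine mul_le_mul_of_nonneg_left ?_ (by norm_num)
    exact Finset.sum_le_sum fun μ _ => Finset.sum_le_sum fun ν _ => (key μ ν).1
  · rw [← mul_assoc, mul_comm ((Real.pi ^ 2 / 4) ^ (2 * d + 4)) (1 / 2), mul_assoc, hdist]
    refine mul_le_mul_of_nonneg_left ?_ (by norm_num)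
    exact Finset.sum_le_sum fun μ _ => Finset.sum_le_sum fun ν _ => (key μ ν).2

/-- the `(1.64)–(1.67)` form data of the unit torus `T₁ = Π_μ ℤ/M_μ` at step `k` (`n = L^k`):
configurations = complex vector fields `B : T₁ → ℂ^d`, `formΔk = ⟨B,Δ_kB⟩` by (1.66), `d1Sq = ⟨∂₁B,∂₁B⟩`
(an instance of the abstract carrier `B5.FormData`; packaging ours).
[cite: Balaban1984PropagatorsI, (1.64)–(1.67) p.29 (packaging ours)] -/
def formOfLattice : B5.FormData where
  Cfg := Tor M × Fin d → ℂ
  formΔk := formDk n M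
  d1Sq := d1Sq M

/-- **`B5.Bounds167` BY NAME** for the unit-torus form carriers: for EVERY family of steps
`n i ≥ 1` («independent of k») and tori `M i`, (1.67) holds with ONE pair of constants
`γ₀ = (4/π²)^{d+2}`, `γ₁ = (π²/4)^{2d+4}` «depending on d only».
[cite: Balaban1984PropagatorsI, (1.67) p.29] -/
theorem bounds167_formOfLattice {I : Type} (n : I → ℕ) (hn : ∀ i, 1 ≤ n i) (M : I → Fin d → ℕ)
    [hM : ∀ i μ, NeZero (M i μ)] :
    B5.Bounds167 (fun i => formOfLattice (n i) (M i)) := by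
  refine ⟨(4 / Real.pi ^ 2) ^ (d + 2), (Real.pi ^ 2 / 4) ^ (2 * d + 4), by positivity,
    by positivity, ?_⟩
  intro i B
  haveI : NeZero (n i) := ⟨by have := hn i; omega⟩
  exact ineq167 (n i) (M i) (hn i) B

/-! ### Real fields -/

/-- a real vector field `B : T₁ → ℝ^d` read as a complex one. [folklore] -/
def ofRealCfg (B : Tor M × Fin d → ℝ) : Tor M × Fin d → ℂ := fun i => (B i : ℂ)

/-- the same form data for REAL vector fields `B : T₁ → ℝ^d` (the fields of B5 are real), through
the embedding `ℝ ⊂ ℂ`. [cite: Balaban1984PropagatorsI, (1.64)–(1.67) p.29 (packaging ours)] -/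
def formOfLatticeR : B5.FormData where
  Cfg := Tor M × Fin d → ℝ
  formΔk := fun B => formDk n M (ofRealCfg M B)
  d1Sq := fun B => d1Sq M (ofRealCfg M B)

/-- `B5.Bounds167` by name for the real unit-torus form carriers, same constants.
[cite: Balaban1984PropagatorsI, (1.67) p.29] -/
theorem bounds167_formOfLatticeR {I : Type} (n : I → ℕ) (hn : ∀ i, 1 ≤ n i) (M : I → Fin d → ℕ)
    [hM : ∀ i μ, NeZero (M i μ)] :
    B5.Bounds167 (fun i => formOfLatticeR (n i) (M i)) := by
  refine ⟨(4 / Real.pi ^ 2) ^ (d + 2), (Real.pi ^ 2 / 4) ^ (2 * d + 4), by positivity,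
    by positivity, ?_⟩
  intro i B
  haveI : NeZero (n i) := ⟨by have := hn i; omega⟩
  exact ineq167 (n i) (M i) (hn i) (ofRealCfg (M i) B)

end Lattice

end Literature.MathematicalPhysics.QuantumFieldTheory.Balaban1983to89.B5Bounds167Lattice

end
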